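import Summits.Ventures.LatticeQCDFlow.Scoring.SU2Conjugacy
import Summits.Ventures.LatticeQCDFlow.Scoring.SU2EntryModulusLaw
import Summits.Ventures.LatticeQCDFlow.Exactness.CompactHaar
import HarnessLib

/-!
# SU(2): the HANDLE IDENTITY `∫ χ_n(A U B U⁻¹) dU = χ_n(A)·χ_n(B)/(n+1)` — without Peter–Weyl

HONEST FRAMING: exact (Metropolis-corrected) sampling algorithms for lattice gauge theory;
figures of merit are autocorrelation/cost numbers at stated couplings and volumes; no
continuum-physics claim.

Venture `LatticeQCDFlow` (cell pub-lqcd), sub-topic `Scoring`; FANOUT row 5 (`s0-sun-a`), GEN-9.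
NEW WORK of the cell (placement rule).  Step 5c of row 5's route to the exact SU(2) torus formula:
the second group-theoretic input of the 2-d character expansion on a closed surface (a link that
occurs twice, with opposite orientations, in the boundary word of one face):

  **`integral_su2Character_handle`** — for all `A, B ∈ SU(2)` and `n ∈ ℕ`,
  `∫ U_n(a₀(A·U·B·U⁻¹)) dHaar(U) = U_n(a₀(A))·U_n(a₀(B))/(n+1)`   (`χ_n = U_n(a₀)`).

Proof (no representation theory): `a₀(A·M) = a₀(A)a₀(M) − ⟨x⃗(A), x⃗(M)⟩` with `M = UBU⁻¹`
(`SU2Conjugacy.su2a0_mul_eq`); by RIGHT invariance `U ↦ Ug` and the conjugacy lemma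
(`SU2Conjugacy.exists_conj_eq`) `B` may be replaced by an element `B₁` whose axis is parallel to
that of `A` (`exists_parallel`, built from the pure part of `A`); then
`⟨x⃗(A), x⃗(UB₁U⁻¹)⟩ = c·‖x⃗(A)‖²·(2Φ(U) − 1)` with `Φ(U) = a₀(U)² + ⟨â, x⃗(U)⟩²`
(`SU2Conjugacy.su2a0_commutator_eq_inner`), `Φ` is UNIFORM on `[0, 1]`
(`SU2EntryModulusLaw.integral_comp_entryNormSq` transported to the direction `â` by the two-angle
law `SU2ClassFunctionConvolution.integral_a0_innerVec_haar`), and the remaining one-dimensional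
integral is `SU2CharacterConvolution.mul_integral_chebyshevU_twoAngle`:
`½∫_{−1}^{1} U_n(cos α cos β + sin α sin β·s) ds = U_n(cos α)U_n(cos β)/(n+1)`.

NOT here (remaining, NOT TYPED): the lattice assembly of `Z_{(ℤ/L)²}^{SU(2)}(β) = Σ_n (c_n/(n+1))^{L²}`
from the character expansion (`SU2CharacterExpansion`), face merging
(`SU2ClassFunctionConvolution.integral_su2Character_mul_conv`) and this handle identity.
-/

noncomputable section

open Real MeasureTheory intervalIntegral Set Metric Polynomial.Chebyshev
open Literature.MathematicalPhysics.QuantumFieldTheory Literature.MathematicalPhysics.QuantumLattice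
open Summit.Ventures.LatticeQCDFlow.Exactness
open scoped RealInnerProductSpace

namespace Summit.Ventures.LatticeQCDFlow.Scoring

/-! ## §1. Conjugation bookkeeping -/

/-- `a₀` is a class function: `a₀(V·B·V⁻¹) = a₀(B)` (trace cyclicity). -/
theorem su2a0_conj (V B : Matrix.specialUnitaryGroup (Fin 2) ℂ) : su2a0 (V * B * V⁻¹) = su2a0 B := by
  rw [su2a0, su2a0]
  have hinv : ((V⁻¹ : Matrix.specialUnitaryGroup (Fin 2) ℂ) : Matrix (Fin 2) (Fin 2) ℂ) =
      star (V : Matrix (Fin 2) (Fin 2) ℂ) := rfl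
  have hVV : star (V : Matrix (Fin 2) (Fin 2) ℂ) * (V : Matrix (Fin 2) (Fin 2) ℂ) = 1 :=
    Matrix.mem_unitaryGroup_iff'.mp (Matrix.specialUnitaryGroup_le_unitaryGroup V.2)
  simp only [Submonoid.coe_mul, hinv]
  rw [Matrix.mul_assoc, Matrix.trace_mul_comm, Matrix.mul_assoc, hVV, Matrix.mul_one]

/-- The rotated axis has the same length: `‖x⃗(V B V⁻¹)‖ = ‖x⃗(B)‖`. -/
theorem norm_su2vec_conj (V B : Matrix.specialUnitaryGroup (Fin 2) ℂ) :
    ‖su2vec (V * B * V⁻¹)‖ = ‖su2vec B‖ := by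
  rw [norm_su2vec_eq, norm_su2vec_eq, su2a0_conj]

/-- **The handle integrand**: `a₀(A·U·B·U⁻¹) = a₀(A)·a₀(B) − ⟨x⃗(A), x⃗(U B U⁻¹)⟩`. -/
theorem su2a0_handle_eq (A V B : Matrix.specialUnitaryGroup (Fin 2) ℂ) :
    su2a0 (A * V * B * V⁻¹) = su2a0 A * su2a0 B - ⟪su2vec A, su2vec (V * B * V⁻¹)⟫ := by
  rw [show A * V * B * V⁻¹ = A * (V * B * V⁻¹) by group, su2a0_mul_eq, su2a0_conj]

/-- **The self-overlap of a rotated axis**: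
`⟨x⃗(B), x⃗(U B U⁻¹)⟩ = (1 − a₀(B)²)(2a₀(U)² − 1) + 2⟨x⃗(U), x⃗(B)⟩²`. -/
theorem inner_su2vec_conj_self (B V : Matrix.specialUnitaryGroup (Fin 2) ℂ) :
    ⟪su2vec B, su2vec (V * B * V⁻¹)⟫ =
      (1 - su2a0 B ^ 2) * (2 * su2a0 V ^ 2 - 1) + 2 * ⟪su2vec V, su2vec B⟫ ^ 2 := by
  have h := su2a0_inv_mul_eq_inner B (V * B * V⁻¹)
  rw [su2a0_conj, show B⁻¹ * (V * B * V⁻¹) = B⁻¹ * V * B * V⁻¹ by group,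
    su2a0_commutator_eq_inner] at h
  linarith [h]

/-- **Right invariance of the handle integral**: replacing `B` by a conjugate does not change
`∫ f(a₀(A·U·B·U⁻¹)) dU`. -/
theorem integral_handle_conj (f : ℝ → ℝ) (A B g : Matrix.specialUnitaryGroup (Fin 2) ℂ) :
    ∫ V, f (su2a0 (A * V * (g * B * g⁻¹) * V⁻¹))
        ∂(haarProbability (Matrix.specialUnitaryGroup (Fin 2) ℂ)) =
      ∫ V, f (su2a0 (A * V * B * V⁻¹)) ∂(haarProbability (Matrix.specialUnitaryGroup (Fin 2) ℂ)) := by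
  have h := integral_mul_right_eq_self (μ := haarProbability (Matrix.specialUnitaryGroup (Fin 2) ℂ))
    (fun V : Matrix.specialUnitaryGroup (Fin 2) ℂ => f (su2a0 (A * V * B * V⁻¹))) g
  rw [← h]
  refine integral_congr_ae (Filter.Eventually.of_forall fun V => ?_)
  simp only [mul_inv_rev]
  congr 2
  group

/-! ## §2. An element with prescribed `a₀` and axis parallel to a given one -/

/-- A quaternion matrix of unit norm is special unitary. -/
theorem mem_specialUnitaryGroup_of_isQuat {M : Matrix (Fin 2) (Fin 2) ℂ} (hM : IsQuat M)
    (h1 : IsQuat.normSq M = 1) : M ∈ Matrix.specialUnitaryGroup (Fin 2) ℂ := by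
  rw [Matrix.mem_specialUnitaryGroup_iff, Matrix.mem_unitaryGroup_iff, Matrix.star_eq_conjTranspose,
    hM.mul_conjTranspose_self, h1, hM.det_eq, h1]
  simp

/-- `|X₀₀|² + |X₀₁|²` of the pure part `X = A − a₀·1` is `1 − a₀²`. -/
theorem normSq_pure (A : Matrix.specialUnitaryGroup (Fin 2) ℂ) :
    IsQuat.normSq ((A : Matrix (Fin 2) (Fin 2) ℂ) - ((su2a0 A : ℝ) : ℂ) • 1) = 1 - su2a0 A ^ 2 := by
  have hb := IsQuat.of_mem_specialUnitaryGroup A.2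
  have hn := IsQuat.normSq_eq_one_of_mem A.2
  unfold IsQuat.normSq at hn ⊢
  rw [Complex.normSq_apply, Complex.normSq_apply] at hn ⊢
  simp [su2a0, Matrix.trace_fin_two, hb.diag, Complex.sub_re, Complex.sub_im,
    Complex.ofReal_re, Complex.ofReal_im, Complex.add_re, Complex.conj_re]
  nlinarith [hn]

/-- **A parallel element**: for `A` with `x⃗(A) ≠ 0` and any `B` there is `B' ∈ SU(2)` with
`a₀(B') = a₀(B)` and `x⃗(B') = (‖x⃗(B)‖/‖x⃗(A)‖)·x⃗(A)` (the matrix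
`a₀(B)·1 + (‖x⃗B‖/‖x⃗A‖)·(A − a₀(A)·1)`). -/
theorem exists_parallel (A B : Matrix.specialUnitaryGroup (Fin 2) ℂ) (hA : su2vec A ≠ 0) :
    ∃ B' : Matrix.specialUnitaryGroup (Fin 2) ℂ,
      su2a0 B' = su2a0 B ∧ su2vec B' = (‖su2vec B‖ / ‖su2vec A‖) • su2vec A := by
  set rA := ‖su2vec A‖ with hrA
  set rB := ‖su2vec B‖ with hrB
  have hrA0 : 0 < rA := norm_pos_iff.mpr hA
  set c : ℝ := rB / rA with hc
  set X : Matrix (Fin 2) (Fin 2) ℂ := (A : Matrix (Fin 2) (Fin 2) ℂ) - ((su2a0 A : ℝ) : ℂ) • 1 with hX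
  set M : Matrix (Fin 2) (Fin 2) ℂ := ((su2a0 B : ℝ) : ℂ) • (1 : Matrix (Fin 2) (Fin 2) ℂ) + (c : ℂ) • X
    with hM
  have hqX : IsQuat X := by
    have h := (IsQuat.of_mem_specialUnitaryGroup A.2).add ((IsQuat.one).smul_real (-su2a0 A))
    rw [hX, sub_eq_add_neg, ← neg_smul, ← Complex.ofReal_neg]; exact h
  have hqM : IsQuat M := ((IsQuat.one).smul_real _).add (hqX.smul_real c)
  -- norm: |M₀₀|² + |M₀₁|² = a₀(B)² + c²(1 − a₀(A)²) = a₀(B)² + rB² = 1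
  have hX00re : (X 0 0).re = 0 := by
    have hb := IsQuat.of_mem_specialUnitaryGroup A.2
    simp [hX, su2a0, Matrix.trace_fin_two, hb.diag, Complex.sub_re, Complex.ofReal_re, Complex.add_re,
      Complex.conj_re]
  have hnX : IsQuat.normSq X = rA ^ 2 := by rw [hX, normSq_pure, hrA, norm_su2vec_sq]
  have hnM : IsQuat.normSq M = 1 := by
    have hB := norm_su2vec_sq B
    have hrB2 : rB ^ 2 = ‖su2vec B‖ ^ 2 := by rw [hrB]
    unfold IsQuat.normSq at hnX ⊢
    rw [Complex.normSq_apply, Complex.normSq_apply] at hnX ⊢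
    have e00 : M 0 0 = ((su2a0 B : ℝ) : ℂ) + (c : ℂ) * X 0 0 := by simp [hM]
    have e01 : M 0 1 = (c : ℂ) * X 0 1 := by simp [hM]
    rw [e00, e01]
    simp only [Complex.add_re, Complex.add_im, Complex.mul_re, Complex.mul_im, Complex.ofReal_re,
      Complex.ofReal_im, zero_mul, sub_zero, add_zero, zero_add]
    have hc2 : c ^ 2 * rA ^ 2 = rB ^ 2 := by rw [hc]; field_simp
    linear_combination c ^ 2 * hnX + hc2 + hrB2 + hB + (2 * su2a0 B * c) * hX00re
  -- the trace of the pure part has zero real part, so `a₀(M) = a₀(B)`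
  have htrX : (Matrix.trace X).re = 0 := by
    have htrA : (Matrix.trace (A : Matrix (Fin 2) (Fin 2) ℂ)).re = 2 * su2a0 A := by
      rw [su2a0]; ring
    rw [hX, Matrix.trace_sub, Matrix.trace_smul, Matrix.trace_one, Complex.sub_re, smul_eq_mul,
      Complex.mul_re, Complex.ofReal_re, Complex.ofReal_im, zero_mul, sub_zero, htrA, Fintype.card_fin]
    norm_num
    ring
  have hMtr : (Matrix.trace M).re / 2 = su2a0 B := by
    rw [hM, Matrix.trace_add, Matrix.trace_smul, Matrix.trace_smul, Matrix.trace_one, Complex.add_re,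
      smul_eq_mul, smul_eq_mul, Complex.mul_re, Complex.mul_re, Complex.ofReal_re, Complex.ofReal_im,
      Complex.ofReal_re, Complex.ofReal_im, htrX, Fintype.card_fin]
    norm_num
  have hMa0 : su2a0 ⟨M, mem_specialUnitaryGroup_of_isQuat hqM hnM⟩ = su2a0 B := hMtr
  refine ⟨⟨M, mem_specialUnitaryGroup_of_isQuat hqM hnM⟩, hMa0, ?_⟩
  · ext k
    rw [PiLp.smul_apply, smul_eq_mul, su2vec_apply_eq_pure, su2vec_apply_eq_pure A, ← hX]
    -- the pure part of M is c·X (its a₀ is a₀(B))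
    have hpure : ((⟨M, mem_specialUnitaryGroup_of_isQuat hqM hnM⟩ : Matrix.specialUnitaryGroup (Fin 2) ℂ) :
        Matrix (Fin 2) (Fin 2) ℂ) - ((su2a0 ⟨M, mem_specialUnitaryGroup_of_isQuat hqM hnM⟩ : ℝ) : ℂ) • 1 =
        (c : ℂ) • X := by
      rw [hMa0]
      show M - ((su2a0 B : ℝ) : ℂ) • 1 = (c : ℂ) • X
      rw [hM]; abel
    rw [hpure, Matrix.mul_smul, Matrix.trace_smul, smul_eq_mul, Complex.mul_re, Complex.ofReal_re,
      Complex.ofReal_im, zero_mul, sub_zero]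
    ring

/-! ## §3. The handle integral for an axis-parallel pair -/

/-- The law of `Φ_â(U) = a₀(U)² + ⟨â, x⃗(U)⟩²` does not depend on the unit vector `â`: its Haar
expectations are those of `a₀² + x₃²`, i.e. of the uniform law on `[0, 1]`. -/
theorem integral_comp_a0sq_add_innerSq {m : E3} (hm : ‖m‖ = 1) (g : ℝ → ℝ) (hg : Continuous g) :
    ∫ U, g (su2a0 U ^ 2 + ⟪m, su2vec U⟫ ^ 2) ∂(haarProbability (Matrix.specialUnitaryGroup (Fin 2) ℂ)) =
      ∫ v in (0 : ℝ)..1, g v := by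
  have hF : Continuous (Function.uncurry fun t u : ℝ => g (t ^ 2 + u ^ 2)) := by
    have : Continuous fun p : ℝ × ℝ => p.1 ^ 2 + p.2 ^ 2 := by fun_prop
    exact hg.comp this
  have h1 := integral_a0_innerVec_haar hm (fun t u => g (t ^ 2 + u ^ 2)) hF
  -- the same two-angle integral for the direction e₃, where ⟨e₃, x⃗⟩ = x₃
  set e3 : E3 := EuclideanSpace.single 2 (1 : ℝ) with he3
  have he3n : ‖e3‖ = 1 := by simp [he3]
  have h3 := integral_a0_innerVec_haar he3n (fun t u => g (t ^ 2 + u ^ 2)) hF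
  have hx3 : ∀ U : Matrix.specialUnitaryGroup (Fin 2) ℂ, ⟪e3, su2vec U⟫ = su2x genZ3 U := fun U => by
    rw [he3, EuclideanSpace.inner_single_left]; simp [su2vec]
  simp_rw [hx3] at h3
  rw [h1, ← h3, integral_comp_entryNormSq g hg]

/-- **The handle integral for an axis-parallel pair**: if `x⃗(B₁) = c·x⃗(A)` with `c ≠ 0` then
`∫ U_n(a₀(A·U·B₁·U⁻¹)) dU = U_n(a₀(A))·U_n(a₀(B₁))/(n+1)`. -/
theorem integral_handle_parallel (A B₁ : Matrix.specialUnitaryGroup (Fin 2) ℂ) (n : ℕ) {c : ℝ} (hc : c ≠ 0)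
    (hA : su2vec A ≠ 0) (hpar : su2vec B₁ = c • su2vec A) :
    ∫ V, (U ℝ n).eval (su2a0 (A * V * B₁ * V⁻¹)) ∂(haarProbability (Matrix.specialUnitaryGroup (Fin 2) ℂ)) =
      (U ℝ n).eval (su2a0 A) * (U ℝ n).eval (su2a0 B₁) / (n + 1) := by
  set rA := ‖su2vec A‖ with hrA
  have hrA0 : 0 < rA := norm_pos_iff.mpr hA
  set ahat : E3 := rA⁻¹ • su2vec A with hahat
  have hahat1 : ‖ahat‖ = 1 := by
    rw [hahat, norm_smul, Real.norm_eq_abs, abs_inv, abs_of_pos hrA0, inv_mul_cancel₀ hrA0.ne']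
  have hAvec : su2vec A = rA • ahat := by
    rw [hahat, smul_smul, mul_inv_cancel₀ hrA0.ne', one_smul]
  -- the norms: ‖x⃗(B₁)‖² = c² rA² = 1 − a₀(B₁)²
  have hrB : 1 - su2a0 B₁ ^ 2 = c ^ 2 * rA ^ 2 := by
    rw [← norm_su2vec_sq, hpar, norm_smul, mul_pow, Real.norm_eq_abs, sq_abs]
  -- Step 1: the integrand as a function of Φ(U) = a₀(U)² + ⟨â, x⃗(U)⟩²
  have hint : ∀ V : Matrix.specialUnitaryGroup (Fin 2) ℂ, su2a0 (A * V * B₁ * V⁻¹) =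
      su2a0 A * su2a0 B₁ - c * rA ^ 2 * (2 * (su2a0 V ^ 2 + ⟪ahat, su2vec V⟫ ^ 2) - 1) := by
    intro V
    rw [su2a0_handle_eq]
    have h1 : ⟪su2vec A, su2vec (V * B₁ * V⁻¹)⟫ = c⁻¹ * ⟪su2vec B₁, su2vec (V * B₁ * V⁻¹)⟫ := by
      rw [hpar, real_inner_smul_left, ← mul_assoc, inv_mul_cancel₀ hc, one_mul]
    rw [h1, inner_su2vec_conj_self, hrB, hpar, real_inner_smul_right, hAvec, real_inner_smul_right,
      real_inner_comm ahat]
    field_simp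
    ring
  simp_rw [hint]
  -- Step 2: the law of Φ is uniform on [0, 1]
  have hg : Continuous fun v : ℝ => (U ℝ n).eval (su2a0 A * su2a0 B₁ - c * rA ^ 2 * (2 * v - 1)) := by
    have := (U ℝ n).continuous; fun_prop
  rw [integral_comp_a0sq_add_innerSq hahat1 (fun v => (U ℝ n).eval (su2a0 A * su2a0 B₁ -
    c * rA ^ 2 * (2 * v - 1))) hg]
  -- Step 3: the one-dimensional integral; substitute s = 1 − 2v… via `v ↦ 2v − 1` and `s ↦ −s`
  have hsub : ∫ v in (0 : ℝ)..1, (U ℝ n).eval (su2a0 A * su2a0 B₁ - c * rA ^ 2 * (2 * v - 1)) =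
      2⁻¹ * ∫ s in (-1 : ℝ)..1, (U ℝ n).eval (su2a0 A * su2a0 B₁ + c * rA ^ 2 * s) := by
    have h := intervalIntegral.integral_comp_mul_add (a := (0 : ℝ)) (b := 1)
      (fun s : ℝ => (U ℝ n).eval (su2a0 A * su2a0 B₁ + c * rA ^ 2 * s)) (c := -2) (by norm_num) 1
    simp only [smul_eq_mul] at h
    have e : (fun v : ℝ => (U ℝ n).eval (su2a0 A * su2a0 B₁ - c * rA ^ 2 * (2 * v - 1))) =
        fun v => (U ℝ n).eval (su2a0 A * su2a0 B₁ + c * rA ^ 2 * (-2 * v + 1)) := by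
      funext v; ring_nf
    rw [e, h, show (-2 : ℝ) * 0 + 1 = 1 by norm_num, show (-2 : ℝ) * 1 + 1 = -1 by norm_num,
      intervalIntegral.integral_symm]
    ring
  rw [hsub]
  -- write (a₀(A), rA) = (cos α, sin α), (a₀(B₁), |c| rA) = (cos β, sin β) and use the two-angle integral
  have haA : |su2a0 A| ≤ 1 := abs_su2a0_le_one A
  have haB : |su2a0 B₁| ≤ 1 := abs_su2a0_le_one B₁
  have hcosA : Real.cos (Real.arccos (su2a0 A)) = su2a0 A := Real.cos_arccos (abs_le.mp haA).1 (abs_le.mp haA).2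
  have hsinA : Real.sin (Real.arccos (su2a0 A)) = rA := by rw [Real.sin_arccos, hrA, norm_su2vec_eq]
  have hcosB : Real.cos (Real.arccos (su2a0 B₁)) = su2a0 B₁ :=
    Real.cos_arccos (abs_le.mp haB).1 (abs_le.mp haB).2
  have hsinB : Real.sin (Real.arccos (su2a0 B₁)) = |c| * rA := by
    have hpos : 0 < |c| * rA := mul_pos (abs_pos.mpr hc) hrA0
    rw [Real.sin_arccos, hrB, Real.sqrt_eq_iff_mul_self_eq_of_pos hpos]
    rw [show |c| * rA * (|c| * rA) = (|c| * |c|) * (rA * rA) by ring, abs_mul_abs_self]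
    ring
  have key := mul_integral_chebyshevU_twoAngle n (Real.arccos (su2a0 A)) (Real.arccos (su2a0 B₁))
  rw [hcosA, hsinA, hcosB, hsinB] at key
  rw [← chebyshevU_eval_cos_mul_sin n (Real.arccos (su2a0 A)),
    ← chebyshevU_eval_cos_mul_sin n (Real.arccos (su2a0 B₁)), hcosA, hsinA, hcosB, hsinB] at key
  -- key : (n+1) * (rA * (|c| rA)) * ∫ U_n(a₀A a₀B₁ + rA (|c| rA) s) ds = 2 (U_n(a₀A) rA)(U_n(a₀B₁)(|c| rA))
  -- the integral with `c` equals the integral with `|c|` (symmetry s ↦ −s when c < 0)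
  have hsym : ∫ s in (-1 : ℝ)..1, (U ℝ n).eval (su2a0 A * su2a0 B₁ + c * rA ^ 2 * s) =
      ∫ s in (-1 : ℝ)..1, (U ℝ n).eval (su2a0 A * su2a0 B₁ + rA * (|c| * rA) * s) := by
    rcases le_or_gt 0 c with hc0 | hc0
    · rw [abs_of_nonneg hc0]
      refine intervalIntegral.integral_congr fun s _ => ?_
      ring_nf
    · rw [abs_of_neg hc0]
      have h := intervalIntegral.integral_comp_neg (a := (-1 : ℝ)) (b := 1)
        (fun s : ℝ => (U ℝ n).eval (su2a0 A * su2a0 B₁ + rA * (-c * rA) * s))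
      rw [neg_neg] at h
      rw [← h]
      refine intervalIntegral.integral_congr fun s _ => ?_
      ring_nf
  rw [hsym]
  have hprod : ((n : ℝ) + 1) * (rA * (|c| * rA)) ≠ 0 := by
    have : 0 < |c| := abs_pos.mpr hc
    positivity
  have hI : ∫ s in (-1 : ℝ)..1, (U ℝ n).eval (su2a0 A * su2a0 B₁ + rA * (|c| * rA) * s) =
      2 * ((U ℝ n).eval (su2a0 A) * rA * ((U ℝ n).eval (su2a0 B₁) * (|c| * rA))) /
        (((n : ℝ) + 1) * (rA * (|c| * rA))) := by
    rw [eq_div_iff hprod]; linarith [key]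
  rw [hI]
  have hc' : |c| ≠ 0 := abs_ne_zero.mpr hc
  field_simp

/-! ## §4. The handle identity -/

/-- **THE HANDLE IDENTITY ON SU(2).**  For all `A, B ∈ SU(2)` and `n ∈ ℕ`:
`∫ U_n(a₀(A·U·B·U⁻¹)) dHaar(U) = U_n(a₀(A))·U_n(a₀(B))/(n+1)`, i.e.
`∫ χ_n(A U B U⁻¹) dU = χ_n(A)χ_n(B)/dim` for the characters `χ_n = U_n(a₀)` of the
`(n+1)`-dimensional irreducible representations — proved without Peter–Weyl. -/
theorem integral_su2Character_handle (A B : Matrix.specialUnitaryGroup (Fin 2) ℂ) (n : ℕ) :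
    ∫ V, (U ℝ n).eval (su2a0 (A * V * B * V⁻¹)) ∂(haarProbability (Matrix.specialUnitaryGroup (Fin 2) ℂ)) =
      (U ℝ n).eval (su2a0 A) * (U ℝ n).eval (su2a0 B) / (n + 1) := by
  -- degenerate cases: x⃗(A) = 0 or x⃗(B) = 0 — the integrand is constant
  by_cases hA : su2vec A = 0
  · have hsq : su2a0 A ^ 2 = 1 := by
      have h := norm_su2vec_sq A; rw [hA, norm_zero] at h; nlinarith [h]
    simp_rw [su2a0_handle_eq, hA, inner_zero_left, sub_zero]
    rw [MeasureTheory.integral_const, probReal_univ, one_smul]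
    rcases sq_eq_one_iff.mp hsq with h1 | h1
    · rw [h1, one_mul, chebyshevU_eval_one_nat]; field_simp
    · rw [h1, neg_one_mul, U_eval_neg, U_eval_neg, chebyshevU_eval_one_nat]; field_simp
  by_cases hB : su2vec B = 0
  · have hsq : su2a0 B ^ 2 = 1 := by
      have h := norm_su2vec_sq B; rw [hB, norm_zero] at h; nlinarith [h]
    have hzero : ∀ V : Matrix.specialUnitaryGroup (Fin 2) ℂ, su2vec (V * B * V⁻¹) = 0 := fun V => by
      rw [← norm_eq_zero, norm_su2vec_conj, hB, norm_zero]
    simp_rw [su2a0_handle_eq, hzero, inner_zero_right, sub_zero]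
    rw [MeasureTheory.integral_const, probReal_univ, one_smul]
    rcases sq_eq_one_iff.mp hsq with h1 | h1
    · rw [h1, mul_one, chebyshevU_eval_one_nat]; field_simp
    · rw [h1, mul_neg_one, U_eval_neg, U_eval_neg, chebyshevU_eval_one_nat]; field_simp
  -- generic case: move the axis of B parallel to the axis of A
  have hrA0 : 0 < ‖su2vec A‖ := norm_pos_iff.mpr hA
  have hrB0 : 0 < ‖su2vec B‖ := norm_pos_iff.mpr hB
  obtain ⟨B', ha', hv'⟩ := exists_parallel A B hA
  set c : ℝ := ‖su2vec B‖ / ‖su2vec A‖ with hc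
  have hc0 : c ≠ 0 := (div_pos hrB0 hrA0).ne'
  by_cases hanti : su2vec B' = -su2vec B
  · -- B itself is anti-parallel to A: x⃗(B) = −c·x⃗(A)
    have hparB : su2vec B = (-c) • su2vec A := by
      rw [neg_smul, ← hv', hanti, neg_neg]
    exact integral_handle_parallel A B n (neg_ne_zero.mpr hc0) hA hparB
  · obtain ⟨g, hg⟩ := exists_conj_eq B B' ha'.symm hanti
    rw [← integral_handle_conj (fun t => (U ℝ n).eval t) A B g, hg,
      integral_handle_parallel A B' n hc0 hA hv', ha']

end Summit.Ventures.LatticeQCDFlow.Scoring
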